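import Literature.Geometry.Lorentzian.SpacetimeMetricInCoordsCalculus
import Literature.Geometry.Lorentzian.TimeCones
import Summits.FinalStateConjecture.FinalStateConjecture.Theorems.BartnikGapSettlingGapExhaustionContDiffOnPullbackField
import HarnessLib

/-!
# Crux `GapExhaustion` (stmt-FinalStateConjecture-10808), line `photon-shell-pseudoconvexity`:
# stub (E-4) `stub_futureDirected_dichotomy` — orientation dichotomy of a chart-timelike field

Route `BartnikGapSettling`; helper (`--supports stmt-FinalStateConjecture-10808`) landing the
registered sub-stub (E-4) of §1f "ESCAPE" of the globalisation layer. For an immersed chart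
`Φ : E4 → 𝓢.carrier` of a spacetime `𝓢` (smooth on the open `O ⊆ E4`, injective differential on
`O`) and a vector field `Y : E4 → E4`, continuous on a PRECONNECTED set `A ⊆ O` and timelike in
the chart (`𝓢.metricInCoords Φ z (Y z) (Y z) < 0` on `A`), the pushed-forward vectors
`dΦ_z (Y z)`, `z ∈ A`, are either all future-directed or all past-directed (i.e. `dΦ_z (−Y z)` is
future-directed) for the time orientation `τ` of `𝓢`.

Proof (O'Neill 1983, Ch. 5, Lemma 5.32 and its proof: a continuous timelike field over a
connected set selects timecones continuously): each `dΦ_z (Y z)` is causal, so the time function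
`h z := g(τ_{Φ z}, dΦ_z (Y z))` never vanishes on `A` (`val_ne_zero_of_isTimelike_of_isCausal`);
`h` is continuous on `A`, since with the pulled-back orienting field
`τ' y := (dΦ_y)⁻¹ (τ_{Φ y})` — `C^∞` on `O` by the landed bridge `stub_contDiffOn_pullbackField` —
and `dΦ_z` invertible (`isInvertible_mfderiv_of_injective`) one has
`h z = 𝓢.metricInCoords Φ z (τ' z) (Y z)`, a continuous bilinear pairing of continuous maps
(`Spacetime.contDiffOn_metricInCoords`); by the intermediate value theorem on the preconnected
`A` (`IsPreconnected.intermediate_value₂`) `h` has constant sign on `A`.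
-/

noncomputable section

-- instance search through the nested operator types `E4 →L[ℝ] E4 →L[ℝ] ℝ`
set_option maxSynthPendingDepth 3

-- D-0017: single-problem summit, `Summit.<S>.<S>.…` by design (cf. lakefile `weak.linter.dupNamespace`).
set_option linter.dupNamespace false

namespace Summit.FinalStateConjecture.FinalStateConjecture.Theorems

open Set Literature.Geometry.Lorentzian
open scoped Manifold ContDiff Topology

/-- A chart-timelike vector pushes forward to a causal (indeed timelike) tangent vector:
`g(dΦ_z v, dΦ_z v) = 𝓢.metricInCoords Φ z v v < 0`. O'Neill 1983, Ch. 5, p. 140. [folklore] -/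
private theorem futureDichotomy_isCausal (𝓢 : Spacetime.{0} 4) (Φ : E4 → 𝓢.carrier) (z v : E4)
    (hv : 𝓢.metricInCoords Φ z v v < 0) :
    𝓢.metric.IsCausal (mfderiv 𝓘(ℝ, E4) (𝓡 4) Φ z v) :=
  (show 𝓢.metric.IsTimelike (mfderiv 𝓘(ℝ, E4) (𝓡 4) Φ z v) from hv).isCausal

/-- Continuity of the time function `z ↦ g(τ_{Φ z}, dΦ_z (Y z))` on `A`: through the invertible
differentials it is the continuous bilinear pairing `𝓢.metricInCoords Φ z (τ' z) (Y z)` of the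
`C^∞` components with the `C^∞` pulled-back orienting field `τ' = (dΦ)⁻¹ (τ ∘ Φ)`
(`stub_contDiffOn_pullbackField`) and the continuous `Y`. O'Neill 1983, Ch. 5, proof of
Lemma 5.32. [folklore] -/
private theorem futureDichotomy_continuousOn (𝓢 : Spacetime.{0} 4) (Φ : E4 → 𝓢.carrier)
    (O A : Set E4) (Y : E4 → E4) (hO : IsOpen O) (hΦ : ContMDiffOn 𝓘(ℝ, E4) (𝓡 4) ∞ Φ O)
    (hinj : ∀ y ∈ O, Function.Injective (mfderiv 𝓘(ℝ, E4) (𝓡 4) Φ y))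
    (hAO : A ⊆ O) (hY : ContinuousOn Y A) :
    ContinuousOn (fun z ↦ 𝓢.metric.val (Φ z) (𝓢.timeOrientation.vectorField (Φ z))
      (mfderiv 𝓘(ℝ, E4) (𝓡 4) Φ z (Y z))) A := by
  have hτ' : ContDiffOn ℝ ∞ (fun y : E4 =>
      (mfderiv 𝓘(ℝ, E4) (𝓡 4) Φ y).inverse (𝓢.timeOrientation.vectorField (Φ y))) O :=
    stub_contDiffOn_pullbackField 𝓢 Φ O 𝓢.timeOrientation.vectorField hO hΦ hinj
      𝓢.timeOrientation.contMDiff.contMDiffOn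
  have hG : ContDiffOn ℝ ∞ (𝓢.metricInCoords Φ) O := 𝓢.contDiffOn_metricInCoords hO hΦ
  have hcont : ContinuousOn (fun z ↦ 𝓢.metricInCoords Φ z
      ((mfderiv 𝓘(ℝ, E4) (𝓡 4) Φ z).inverse (𝓢.timeOrientation.vectorField (Φ z))) (Y z)) A :=
    ((hG.continuousOn.mono hAO).clm_apply (hτ'.continuousOn.mono hAO)).clm_apply hY
  refine hcont.congr fun z hz ↦ ?_
  have hinv : (mfderiv 𝓘(ℝ, E4) (𝓡 4) Φ z).IsInvertible :=
    PseudoRiemannianMetric.isInvertible_mfderiv_of_injective (I := 𝓡 4) (I' := 𝓘(ℝ, E4)) rfl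
      (hinj z (hAO hz))
  simp only [Spacetime.metricInCoords_apply]
  rw [hinv.self_apply_inverse]

/-- **Stub (E-4) of the line `photon-shell-pseudoconvexity` (crux `GapExhaustion`,
stmt-FinalStateConjecture-10808) — orientation dichotomy.** Let `Φ : E4 → 𝓢.carrier` be smooth on
the open set `O` with injective differential there, `A ⊆ O` preconnected, and `Y : E4 → E4`
continuous on `A` and chart-timelike on `A` (`𝓢.metricInCoords Φ z (Y z) (Y z) < 0`). Then either
`dΦ_z (Y z)` is future-directed for every `z ∈ A`, or `dΦ_z (−Y z)` is future-directed for every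
`z ∈ A`: the continuous nowhere-vanishing time function `g(τ, dΦ Y)` has constant sign on the
preconnected `A` (intermediate value theorem). O'Neill 1983, Ch. 5, Lemma 5.32 (a timelike
vector field over a connected set selects timecones continuously). [cite: ONeill1983, Ch. 5, Lemma 5.32] -/
theorem stub_futureDirected_dichotomy :
    ∀ (𝓢 : Spacetime.{0} 4) (Φ : E4 → 𝓢.carrier) (O A : Set E4) (Y : E4 → E4),
      IsOpen O → ContMDiffOn 𝓘(ℝ, E4) (𝓡 4) ∞ Φ O →
      (∀ y ∈ O, Function.Injective (mfderiv 𝓘(ℝ, E4) (𝓡 4) Φ y)) →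
      A ⊆ O → IsPreconnected A → ContinuousOn Y A →
      (∀ z ∈ A, 𝓢.metricInCoords Φ z (Y z) (Y z) < 0) →
      (∀ z ∈ A, 𝓢.timeOrientation.IsFutureDirected (mfderiv 𝓘(ℝ, E4) (𝓡 4) Φ z (Y z))) ∨
      (∀ z ∈ A, 𝓢.timeOrientation.IsFutureDirected (mfderiv 𝓘(ℝ, E4) (𝓡 4) Φ z (-Y z))) := by
  intro 𝓢 Φ O A Y hO hΦ hinj hAO hA hY hneg
  -- the time function `h z = g(τ_{Φ z}, dΦ_z (Y z))`
  set h : E4 → ℝ := fun z ↦ 𝓢.metric.val (Φ z) (𝓢.timeOrientation.vectorField (Φ z))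
    (mfderiv 𝓘(ℝ, E4) (𝓡 4) Φ z (Y z)) with h_def
  have hcausal : ∀ z ∈ A, 𝓢.metric.IsCausal (mfderiv 𝓘(ℝ, E4) (𝓡 4) Φ z (Y z)) :=
    fun z hz ↦ futureDichotomy_isCausal 𝓢 Φ z (Y z) (hneg z hz)
  have hne : ∀ z ∈ A, h z ≠ 0 := fun z hz ↦
    𝓢.metric.val_ne_zero_of_isTimelike_of_isCausal (𝓢.timeOrientation.isTimelike (Φ z))
      (hcausal z hz)
  have hcont : ContinuousOn h A := futureDichotomy_continuousOn 𝓢 Φ O A Y hO hΦ hinj hAO hY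
  by_cases hall : ∀ z ∈ A, h z < 0
  · exact Or.inl fun z hz ↦ ⟨hcausal z hz, hall z hz⟩
  · push Not at hall
    obtain ⟨z₀, hz₀, hz₀'⟩ := hall
    have hpos₀ : 0 < h z₀ := lt_of_le_of_ne hz₀' (hne z₀ hz₀).symm
    refine Or.inr fun z hz ↦ ?_
    -- `h z ≤ 0 < h z₀` would produce a zero of `h` on the preconnected `A`
    have hpos : 0 < h z := not_le.mp fun hle ↦ by
      obtain ⟨w, hw, hw0⟩ :=
        hA.intermediate_value₂ hz hz₀ hcont continuousOn_const hle hpos₀.le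
      exact hne w hw hw0
    have hmn : mfderiv 𝓘(ℝ, E4) (𝓡 4) Φ z (-Y z) = -(mfderiv 𝓘(ℝ, E4) (𝓡 4) Φ z (Y z)) :=
      (mfderiv 𝓘(ℝ, E4) (𝓡 4) Φ z).map_neg (Y z)
    rw [hmn, TimeOrientation.isFutureDirected_neg_iff]
    exact ⟨hcausal z hz, hpos⟩

end Summit.FinalStateConjecture.FinalStateConjecture.Theorems

end
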